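import Mathlib
import Summits.Ventures.HodgeRepro.OcticCMPointTruncModel
import Summits.Ventures.HodgeRepro.OcticCMPointTruncTwist

/-!
# OcticCMPointTruncThree — the Gauss sum of the explicit twist at conductor `3` on `𝒪/𝔭³`: a quadratic Gauss sum

Blind re-derivation cell `pub-hodge-repro`, seat night-2 (gen 4).  Target tree path
`lean/Summits/Ventures/HodgeRepro/OcticCMPointTruncThree.lean`.  The odd-conductor companion of
`OcticCMPointTruncFour.lean` on `Trunc k 3 = k[ϖ]/(ϖ³)` (`𝒪/𝔭³` at `𝔭₁, 𝔭₂ | 5`).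

* `ofCoords3 a b c = a + bϖ + cϖ²`, `coords3 : Trunc k 3 ≃ k × k × k`; `(trLog (bϖ + cϖ²))₂ = c − b²/2`;
* **`gaussSum_twist_three`**: for the wild twist `ρ = twist 1 ψ₀` and `ψ₀` primitive,
  `∑_x ρ⁻¹(x) ψ̃(x) = |k| · ∑_b ψ₀(b²/2)` — the sum over `c` forces `a = 1`; the stationary phase at an ODD
  conductor is a QUADRATIC Gauss sum;
* `sum_psi_sq`: `∑_b ψ₀(b²/2) = G(χ, ψ₀(·/2))` for the quadratic character `χ` of `k` (`#{b : b² = a} = χ(a) + 1`,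
  Mathlib `quadraticChar_card_sqrts`), so by Mathlib's `gaussSum_sq` its square is `χ(−1) |k|`;
* **`eps_twist_three_sq`**: Kudla's `ε(½, ρ, ψ)` on the model satisfies `ε² = ρ(ϖ)^{2n} · χ(−1)` for
  `κ² |k|³ = 1` (`κ = |R|^{−1/2}`); at `𝔭 | 5` (`k = 𝔽₅`, `−1` a square) `ε² = ρ(ϖ)^{2n}`
  (`eps_twist_three_sq_p5`) — the sign of the conductor-`3` twist is `ρ(ϖ)^n` times a fourth root of unity
  whose square is `χ(−1)`, consistent with `eps_sign_trunc` (`OcticCMPointTruncSign.lean`).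

**What this is not.**  The SIGN of the quadratic Gauss sum (Gauss's theorem) is not in Mathlib and not derived
here; `c ≥ 5` and `𝔮 | 2` are not covered.  Nothing here says anything about the status of the Hodge conjecture
for CM abelian varieties, which is NOT proved.
-/

set_option autoImplicit false

noncomputable section

open Finset Polynomial

namespace Summit.Ventures.HodgeRepro.PeriodCloser

open GaussSumStability

namespace TruncModel

variable {k : Type} [Field k]

/-! ### Coordinates on `k[ϖ]/(ϖ³)` -/

/-- `a + bϖ + cϖ²`. -/
def ofCoords3 (a b c : k) : Trunc k 3 :=
  algebraMap k (Trunc k 3) a + algebraMap k (Trunc k 3) b * varpi 3 ^ 1 + algebraMap k (Trunc k 3) c * varpi 3 ^ 2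

/-- `coeffAt i (ϖ^j) = [i = j]` for `i < c`. -/
theorem coeffAt_varpi_pow' (c : ℕ) (i : ℕ) (hi : i < c) (j : ℕ) :
    coeffAt c i ((varpi c : Trunc k c) ^ j) = if i = j then 1 else 0 := by
  rw [varpi, ← AdjoinRoot.mk_X, ← map_pow, coeffAt_mk_of_lt c _ hi, coeff_X_pow]

/-- `coeffAt i (algebraMap a) = [i = 0] a` for `i < c`. -/
theorem coeffAt_algebraMap' (c : ℕ) (i : ℕ) (hi : i < c) (a : k) :
    coeffAt c i (algebraMap k (Trunc k c) a) = if i = 0 then a else 0 := by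
  rw [AdjoinRoot.algebraMap_eq, ← AdjoinRoot.mk_C, coeffAt_mk_of_lt c _ hi, coeff_C]

/-- `coeffAt i (ofCoords3 a b c)` in general. -/
theorem coeffAt_ofCoords3_eq (a b c : k) (i : ℕ) (hi : i < 3) :
    coeffAt 3 i (ofCoords3 a b c) = (if i = 0 then a else 0) + b * (if i = 1 then 1 else 0) +
      c * (if i = 2 then 1 else 0) := by
  rw [ofCoords3, map_add, map_add, coeffAt_algebraMap_mul, coeffAt_algebraMap_mul, coeffAt_algebraMap' 3 i hi,
    coeffAt_varpi_pow' 3 i hi, coeffAt_varpi_pow' 3 i hi]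

/-- The coordinates of `ofCoords3 a b c`. -/
theorem coeffAt_ofCoords3 (a b c : k) :
    coeffAt 3 0 (ofCoords3 a b c) = a ∧ coeffAt 3 1 (ofCoords3 a b c) = b ∧ coeffAt 3 2 (ofCoords3 a b c) = c := by
  refine ⟨?_, ?_, ?_⟩
  · rw [coeffAt_ofCoords3_eq a b c 0 (by norm_num)]; norm_num
  · rw [coeffAt_ofCoords3_eq a b c 1 (by norm_num)]; norm_num
  · rw [coeffAt_ofCoords3_eq a b c 2 (by norm_num)]; norm_num

/-- Every element of `k[ϖ]/(ϖ³)` is `ofCoords3` of its coordinates. -/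
theorem eq_ofCoords3 (x : Trunc k 3) : x = ofCoords3 (coeffAt 3 0 x) (coeffAt 3 1 x) (coeffAt 3 2 x) := by
  obtain ⟨p, rfl, hp⟩ := exists_rep 3 (by norm_num) x
  simp only [coeffAt_mk_of_lt 3 p (show (0 : ℕ) < 3 by norm_num), coeffAt_mk_of_lt 3 p (show (1 : ℕ) < 3 by norm_num),
    coeffAt_mk_of_lt 3 p (show (2 : ℕ) < 3 by norm_num)]
  conv_lhs => rw [p.as_sum_range' 3 hp]
  simp only [Finset.sum_range_succ, Finset.sum_range_zero, zero_add, map_add, ← C_mul_X_pow_eq_monomial,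
    map_mul, map_pow, AdjoinRoot.mk_C, AdjoinRoot.mk_X, ofCoords3, AdjoinRoot.algebraMap_eq, pow_zero, mul_one]

/-- **The coordinates** `k[ϖ]/(ϖ³) ≃ k³`. -/
def coords3 : Trunc k 3 ≃ k × k × k where
  toFun x := (coeffAt 3 0 x, coeffAt 3 1 x, coeffAt 3 2 x)
  invFun v := ofCoords3 v.1 v.2.1 v.2.2
  left_inv x := (eq_ofCoords3 x).symm
  right_inv v := by
    obtain ⟨a, b, c⟩ := v
    obtain ⟨h0, h1, h2⟩ := coeffAt_ofCoords3 a b c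
    simp only [h0, h1, h2]

/-- `coords3.symm (a, b, c) = ofCoords3 a b c`. -/
theorem coords3_symm_apply (a b c : k) : coords3.symm (a, b, c) = ofCoords3 a b c := rfl

/-! ### The top coefficient of the logarithm in coordinates -/

/-- `(bϖ + cϖ²)² = b²ϖ²`. -/
theorem ofCoords3_zero_sq (b c : k) : ofCoords3 0 b c ^ 2 = ofCoords3 0 0 (b ^ 2) := by
  have h3 : (varpi 3 : Trunc k 3) ^ 3 = 0 := varpi_pow_c 3
  simp only [ofCoords3, map_zero, zero_add, map_pow]
  linear_combination (2 * algebraMap k (Trunc k 3) b * algebraMap k (Trunc k 3) c +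
    algebraMap k (Trunc k 3) c ^ 2 * varpi 3) * h3

/-- `(bϖ + cϖ²)³ = 0`. -/
theorem ofCoords3_zero_cube (b c : k) : ofCoords3 0 b c ^ 3 = 0 := by
  have h3 : (varpi 3 : Trunc k 3) ^ 3 = 0 := varpi_pow_c 3
  simp only [ofCoords3, map_zero, zero_add]
  linear_combination (algebraMap k (Trunc k 3) b + algebraMap k (Trunc k 3) c * varpi 3) ^ 3 * h3

/-- **The top coefficient of the logarithm**: `(trLog (bϖ + cϖ²))₂ = c − b²/2`. -/
theorem coeffAt_two_trLog (b c : k) : coeffAt 3 2 (trLog 3 (ofCoords3 0 b c)) = c - (2 : k)⁻¹ * b ^ 2 := by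
  rw [trLog, ofCoords3_zero_sq, ofCoords3_zero_cube, mul_zero, add_zero, map_sub, coeffAt_algebraMap_mul,
    (coeffAt_ofCoords3 0 b c).2.2, (coeffAt_ofCoords3 0 0 (b ^ 2)).2.2]

/-! ### The twist in coordinates -/

/-- `ofCoords3 a b c` is a unit iff `a ≠ 0`. -/
theorem isUnit_ofCoords3_iff (a b c : k) : IsUnit (ofCoords3 a b c) ↔ a ≠ 0 := by
  rw [← not_iff_not, not_not, ← hloc 3 (by norm_num), mem_maxIdeal_iff_coeff 3 (by norm_num),
    (coeffAt_ofCoords3 a b c).1]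

/-- `red (a + bϖ + cϖ²) = (b/a)ϖ + (c/a)ϖ²` for `a ≠ 0`. -/
theorem red_ofCoords3 {a : k} (ha : a ≠ 0) (b c : k) :
    red 3 (ofCoords3 a b c) = ofCoords3 0 (a⁻¹ * b) (a⁻¹ * c) := by
  rw [red, (coeffAt_ofCoords3 a b c).1]
  simp only [ofCoords3, map_zero, zero_add, mul_add, ← mul_assoc, ← map_mul, inv_mul_cancel₀ ha, map_one]
  ring

/-- `ψ̃(a + bϖ + cϖ²) = ψ₀(c)`. -/
theorem psiTilde_ofCoords3 (ψ₀ : AddChar k ℂ) (a b c : k) : psiTilde 3 ψ₀ (ofCoords3 a b c) = ψ₀ c := by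
  rw [psiTilde_apply, (coeffAt_ofCoords3 a b c).2.2]

/-- **The wild twist in coordinates**: for `a ≠ 0`, `ρ(a + bϖ + cϖ²) = ψ₀(c/a − (b/a)²/2)`. -/
theorem twist_one_ofCoords3 (h2 : (2 : k) ≠ 0) (h3 : (3 : k) ≠ 0) (ψ₀ : AddChar k ℂ) {a : k} (ha : a ≠ 0)
    (b c : k) :
    twist 3 (by norm_num) (by norm_num) h2 h3 1 ψ₀ (ofCoords3 a b c) =
      ψ₀ (a⁻¹ * c - (2 : k)⁻¹ * (a⁻¹ * b) ^ 2) := by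
  rw [twist_apply, if_pos ((isUnit_ofCoords3_iff a b c).2 ha), (coeffAt_ofCoords3 a b c).1,
    MulChar.one_apply (isUnit_iff_ne_zero.2 ha), one_mul, red_ofCoords3 ha, coeffAt_two_trLog]

/-- The twist vanishes off the units. -/
theorem twist_one_ofCoords3_zero (h2 : (2 : k) ≠ 0) (h3 : (3 : k) ≠ 0) (ψ₀ : AddChar k ℂ) (b c : k) :
    twist 3 (by norm_num) (by norm_num) h2 h3 1 ψ₀ (ofCoords3 0 b c) = 0 := by
  apply MulChar.map_nonunit
  rw [isUnit_ofCoords3_iff]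
  exact fun h => h rfl

/-! ### The Gauss sum of the wild twist at conductor `3` -/

/-- The summand of the Gauss sum in coordinates. -/
theorem gauss_term3 [DecidableEq k] (h2 : (2 : k) ≠ 0) (h3 : (3 : k) ≠ 0) (ψ₀ : AddChar k ℂ) (a b c : k) :
    (twist 3 (by norm_num) (by norm_num) h2 h3 1 ψ₀)⁻¹ (ofCoords3 a b c) * psiTilde 3 ψ₀ (ofCoords3 a b c) =
      if a = 0 then 0 else ψ₀ ((2 : k)⁻¹ * (a⁻¹ * b) ^ 2) * ψ₀ (c * (1 - a⁻¹)) := by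
  rw [MulChar.inv_apply_eq_inv', psiTilde_ofCoords3]
  by_cases ha : a = 0
  · subst ha
    rw [if_pos rfl, twist_one_ofCoords3_zero, inv_zero, zero_mul]
  · rw [if_neg ha, twist_one_ofCoords3 h2 h3 ψ₀ ha, ← AddChar.map_neg_eq_inv, ← AddChar.map_add_eq_mul,
      ← AddChar.map_add_eq_mul]
    congr 1
    ring

/-- **The Gauss sum of the wild twist at conductor `3`**: `∑_x ρ⁻¹(x) ψ̃(x) = |k| · ∑_b ψ₀(b²/2)` (`ψ₀`
primitive): the sum over `c` forces `a = 1`, and a quadratic Gauss sum in `b` remains. -/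
theorem gaussSum_twist_three [Fintype k] [DecidableEq k] (h2 : (2 : k) ≠ 0) (h3 : (3 : k) ≠ 0)
    (ψ₀ : AddChar k ℂ) (h₀ : ψ₀.IsPrimitive) :
    gaussSum (twist 3 (by norm_num) (by norm_num) h2 h3 1 ψ₀)⁻¹ (psiTilde 3 ψ₀) =
      (Fintype.card k : ℂ) * ∑ b : k, ψ₀ ((2 : k)⁻¹ * b ^ 2) := by
  unfold gaussSum
  rw [← Equiv.sum_comp coords3.symm]
  simp only [Fintype.sum_prod_type]
  simp only [coords3_symm_apply, gauss_term3 h2 h3 ψ₀]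
  have hc : ∀ a b : k, (∑ c : k, if a = 0 then (0 : ℂ) else ψ₀ ((2 : k)⁻¹ * (a⁻¹ * b) ^ 2) * ψ₀ (c * (1 - a⁻¹))) =
      if a = 1 then (Fintype.card k : ℂ) * ψ₀ ((2 : k)⁻¹ * b ^ 2) else 0 := by
    intro a b
    by_cases ha : a = 0
    · subst ha
      simp only [if_true, Finset.sum_const_zero, zero_ne_one, if_false]
    · simp only [ha, if_false]
      rw [← Finset.mul_sum, AddChar.sum_mulShift _ h₀]
      by_cases ha1 : a = 1
      · subst ha1
        simp only [inv_one, sub_self, if_true, mul_one, mul_comm]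
      · have : (1 : k) - a⁻¹ ≠ 0 := by
          intro h
          apply ha1
          have : a⁻¹ = 1 := by linear_combination -h
          rwa [inv_eq_one] at this
        simp only [this, if_false, Nat.cast_zero, mul_zero, ha1]
  simp only [hc]
  rw [Finset.sum_eq_single (1 : k) (fun a _ ha => by simp only [ha, if_false, Finset.sum_const_zero])
    (fun h => absurd (Finset.mem_univ _) h)]
  simp only [if_true, ← Finset.mul_sum]

/-! ### The quadratic Gauss sum -/

/-- The quadratic character of `k` with complex values. -/
def quadChar (k : Type) [Field k] [Fintype k] [DecidableEq k] : MulChar k ℂ :=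
  (quadraticChar k).ringHomComp (Int.castRingHom ℂ)

/-- `ringChar k ≠ 2` when `2 ≠ 0` in `k`. -/
theorem ringChar_ne_two (h2 : (2 : k) ≠ 0) : ringChar k ≠ 2 := by
  intro h
  apply h2
  have := ringChar.Nat.cast_ringChar (R := k)
  rw [h] at this
  exact_mod_cast this

/-- **The sum over squares is a Gauss sum**: `∑_b φ(b²) = G(χ, φ)` for a primitive `φ` and the quadratic
character `χ` (`#{b : b² = a} = χ(a) + 1`; `∑_a φ(a) = 0`). -/
theorem sum_sq_eq_gaussSum [Fintype k] [DecidableEq k] (h2 : (2 : k) ≠ 0) (φ : AddChar k ℂ) (hφ : φ.IsPrimitive) :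
    ∑ b : k, φ (b ^ 2) = gaussSum (quadChar k) φ := by
  rw [← Finset.sum_fiberwise' Finset.univ (fun b : k => b ^ 2) (fun a => φ a)]
  simp only [Finset.sum_const, nsmul_eq_mul]
  have hcount : ∀ a : k, ((Finset.univ.filter fun b : k => b ^ 2 = a).card : ℂ) = quadChar k a + 1 := by
    intro a
    have h := quadraticChar_card_sqrts (ringChar_ne_two h2) a
    rw [Set.toFinset_setOf] at h
    rw [quadChar, MulChar.ringHomComp_apply, eq_intCast]
    exact_mod_cast h
  simp only [hcount, add_mul, one_mul, Finset.sum_add_distrib]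
  have hne : φ ≠ 1 := by
    have := hφ one_ne_zero
    rwa [AddChar.mulShift_one] at this
  rw [AddChar.sum_eq_zero_of_ne_one hne, add_zero]
  rfl

/-- The shift `ψ₀(2⁻¹ ·)` of a primitive character is primitive. -/
theorem mulShift_half_isPrimitive (h2 : (2 : k) ≠ 0) (ψ₀ : AddChar k ℂ) (h₀ : ψ₀.IsPrimitive) :
    (AddChar.mulShift ψ₀ (2 : k)⁻¹).IsPrimitive := by
  intro a ha
  rw [AddChar.mulShift_mulShift]
  exact h₀ (mul_ne_zero (inv_ne_zero h2) ha)

/-- **`∑_b ψ₀(b²/2)` is the quadratic Gauss sum** `G(χ, ψ₀(·/2))`. -/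
theorem sum_psi_sq [Fintype k] [DecidableEq k] (h2 : (2 : k) ≠ 0) (ψ₀ : AddChar k ℂ) (h₀ : ψ₀.IsPrimitive) :
    ∑ b : k, ψ₀ ((2 : k)⁻¹ * b ^ 2) = gaussSum (quadChar k) (AddChar.mulShift ψ₀ (2 : k)⁻¹) := by
  rw [← sum_sq_eq_gaussSum h2 _ (mulShift_half_isPrimitive h2 ψ₀ h₀)]
  simp only [AddChar.mulShift_apply]

/-- The quadratic character is non-trivial and quadratic (complex values). -/
theorem quadChar_ne_one [Fintype k] [DecidableEq k] (h2 : (2 : k) ≠ 0) : quadChar k ≠ 1 :=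
  (MulChar.ringHomComp_ne_one_iff Int.cast_injective).2 (quadraticChar_ne_one (ringChar_ne_two h2))

/-- The complex quadratic character is quadratic. -/
theorem quadChar_isQuadratic [Fintype k] [DecidableEq k] : (quadChar k).IsQuadratic :=
  (quadraticChar_isQuadratic k).comp _

/-- **The square of the quadratic Gauss sum**: `G(χ, ψ₀(·/2))² = χ(−1) · |k|` (Mathlib `gaussSum_sq`). -/
theorem gaussSum_quad_sq [Fintype k] [DecidableEq k] (h2 : (2 : k) ≠ 0) (ψ₀ : AddChar k ℂ) (h₀ : ψ₀.IsPrimitive) :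
    gaussSum (quadChar k) (AddChar.mulShift ψ₀ (2 : k)⁻¹) ^ 2 = quadChar k (-1) * (Fintype.card k : ℂ) :=
  gaussSum_sq (quadChar_ne_one h2) quadChar_isQuadratic (mulShift_half_isPrimitive h2 ψ₀ h₀)

/-! ### The local root number of the conductor-`3` twist -/

/-- **Kudla's `ε(s, ρ, ψ)` of the conductor-`3` wild twist on the model**: `ε = ρ(ϖ)^n · κ · |k| · G(χ, ψ₀(·/2))`. -/
theorem eps_twist_three [Fintype k] [DecidableEq k] (h2 : (2 : k) ≠ 0) (h3 : (3 : k) ≠ 0) (ψ₀ : AddChar k ℂ)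
    (h₀ : ψ₀.IsPrimitive) (κ : ℂ) (n : ℕ) (π : ℂ) :
    LocalChar.eps κ n (⟨twist 3 (by norm_num) (by norm_num) h2 h3 1 ψ₀, π⟩ : LocalChar (Trunc k 3))
      (psiTilde 3 ψ₀) = π ^ n * κ * ((Fintype.card k : ℂ) * gaussSum (quadChar k) (AddChar.mulShift ψ₀ (2 : k)⁻¹)) := by
  unfold LocalChar.eps LocalChar.gauss
  rw [gaussSum_twist_three h2 h3 ψ₀ h₀, sum_psi_sq h2 ψ₀ h₀]

/-- **The square of the root number of the conductor-`3` twist**: `ε² = ρ(ϖ)^{2n} · χ(−1)` with the `s = ½`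
constant `κ² |k|³ = 1` (`κ = |R|^{−1/2}`, `|R| = |k|³`). -/
theorem eps_twist_three_sq [Fintype k] [DecidableEq k] (h2 : (2 : k) ≠ 0) (h3 : (3 : k) ≠ 0) (ψ₀ : AddChar k ℂ)
    (h₀ : ψ₀.IsPrimitive) (κ : ℂ) (hκ : κ ^ 2 * (Fintype.card k : ℂ) ^ 3 = 1) (n : ℕ) (π : ℂ) :
    LocalChar.eps κ n (⟨twist 3 (by norm_num) (by norm_num) h2 h3 1 ψ₀, π⟩ : LocalChar (Trunc k 3))
      (psiTilde 3 ψ₀) ^ 2 = π ^ (2 * n) * quadChar k (-1) := by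
  rw [eps_twist_three h2 h3 ψ₀ h₀ κ n π, mul_pow, mul_pow, mul_pow, gaussSum_quad_sq h2 ψ₀ h₀, ← pow_mul]
  calc π ^ (n * 2) * κ ^ 2 * ((Fintype.card k : ℂ) ^ 2 * (quadChar k (-1) * (Fintype.card k : ℂ))) =
      π ^ (n * 2) * (κ ^ 2 * (Fintype.card k : ℂ) ^ 3) * quadChar k (-1) := by ring
    _ = π ^ (2 * n) * quadChar k (-1) := by rw [hκ, mul_one, mul_comm n 2]

/-- At `𝔭₁, 𝔭₂ | 5`: `−1` is a square in `𝔽₅` (`5 ≡ 1 (mod 4)`), so `χ(−1) = 1`. -/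
theorem quadChar_neg_one_p5 : quadChar (ZMod 5) (-1) = 1 := by
  have h : quadraticChar (ZMod 5) (-1) = 1 := by
    rw [quadraticChar_one_iff_isSquare (neg_ne_zero.2 one_ne_zero), FiniteField.isSquare_neg_one_iff, ZMod.card]
    decide
  rw [quadChar, MulChar.ringHomComp_apply, h]
  simp

/-- **At `𝔭₁, 𝔭₂ | 5` the root number of the conductor-`3` twist squares to `ρ(ϖ)^{2n}`** (`κ² · 5³ = 1`). -/
theorem eps_twist_three_sq_p5 (ψ₀ : AddChar (ZMod 5) ℂ) (h₀ : ψ₀.IsPrimitive) (κ : ℂ) (hκ : κ ^ 2 * 125 = 1)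
    (n : ℕ) (π : ℂ) :
    LocalChar.eps κ n (⟨twist 3 (by norm_num) (by norm_num) (by decide) (by decide) 1 ψ₀, π⟩ :
      LocalChar (Trunc (ZMod 5) 3)) (psiTilde 3 ψ₀) ^ 2 = π ^ (2 * n) := by
  rw [eps_twist_three_sq (by decide) (by decide) ψ₀ h₀ κ (by rw [ZMod.card]; exact_mod_cast hκ) n π,
    quadChar_neg_one_p5, mul_one]

/-- **The twisted tame lines at conductor `3`**: gen 1's stability on `I = (ϖ²)` with the primitive twist
(`a = 1`) and a shallow tame line gives `ε(½, χρ, ψ̃) = χ(ϖ)^n · ε(½, ρ, ψ̃) = (χ(ϖ)ρ(ϖ))^n · κ |k| · G(χ_quad, ψ₀(·/2))`;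
(E3) for four such lines is again the `ϖ`-part of N2 (the common factor `(κ|k|G)²` cancels). -/
theorem eps_tame_twist_three [Fintype k] [DecidableEq k] (h2 : (2 : k) ≠ 0) (h3 : (3 : k) ≠ 0)
    (ψ₀ : AddChar k ℂ) (h₀ : ψ₀.IsPrimitive) (κ : ℂ) (n : ℕ) (θ : MulChar k ℂ) (πχ π : ℂ) :
    LocalChar.eps κ n ((⟨tame 3 (by norm_num) θ, πχ⟩ : LocalChar (Trunc k 3)) *
      ⟨twist 3 (by norm_num) (by norm_num) h2 h3 1 ψ₀, π⟩) (psiTilde 3 ψ₀) =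
      (πχ * π) ^ n * (κ * ((Fintype.card k : ℂ) * gaussSum (quadChar k) (AddChar.mulShift ψ₀ (2 : k)⁻¹))) := by
  rw [LocalChar.eps_mul_eq κ n _ _ (psiTilde 3 ψ₀) (Ideal.span {(varpi 3 : Trunc k 3) ^ 2})
    (pow_mul_eq_zero_of_le 3 2 (by norm_num)) 1
    (primitive_twist 3 (by norm_num) (by norm_num) h2 h3 1 ψ₀ π 2 (by norm_num) (by norm_num))
    (shallow_tame 3 (by norm_num) θ ψ₀ h₀ πχ 2 (by norm_num)),
    eps_twist_three h2 h3 ψ₀ h₀ κ n π, LocalChar.cRho, Units.val_one, MulChar.map_one, inv_one, mul_one, mul_pow]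
  ring

end TruncModel

end Summit.Ventures.HodgeRepro.PeriodCloser

end
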